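import Summits.BirchSwinnertonDyer.BirchSwinnertonDyer.Statement
import HarnessLib

/-!
# SoloInformedLeadingFormParity — the leading form of a two-variable height determinant is even in the weight variable

Kernel algebra behind predictions P1′/P4′ of notebook §23.8/§25 (claims C101, C103, C108).
In the two-variable leading-term model, the lowest-order part of the Hida-family `7`-adic
`L`-function of `389a1` near `(w, T) = (0, 0)` is (a unit times) the determinant of a pairing
matrix `x • S + w • A` on `E(ℚ) ≅ ℤ²`, where `x = T - w/2` is the distance to the central line,
`S` is the SYMMETRIC cyclotomic height Gram matrix (determinant = the regulator `Reg₇`) and `A`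
is the ALTERNATING weight-direction part.  Two consequences are used in §25:

* `soloInformed_det_symm_add_skew`: for `S` symmetric and `A` skew, `det (x • S + w • A) =
  det (x • S - w • A)` (transpose), in every size: the leading form has no odd powers of `w`;
  in particular no `x · w` cross term — the structural reason for P1′ (`c₁ = 0` in
  `ρ(w) = ẽ₀/ẽ₂ = Σ c_j w^j`).
* `soloInformed_det_fin_two_leadingForm`: in rank `2` explicitly
  `det (x • S + w • A) = x² · det S + w² · c²` (`c` the Pfaffian of `A`), so the ratio of the
  `w²`- to the `x²`-coefficient is `c² / det S`, whose square class is that of `det S = Reg₇`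
  (`soloInformed_ratio_class`): with `U₀(k) ≈ -c₂ w_k²` this gives
  `class(U₀(k)) = class(-Reg₇(389a1))`, which the probe job j054421 found to be the trivial
  class (`Reg₇ = 6·7² + 3·7⁴ + …`, `-6 ≡ 1 (mod 7)`): prediction C108, "both near-central zeros
  are `ℚ₇`-rational at every classical weight of the family".

Only the matrix algebra is certified here; the identification of the leading form with a height
determinant is the (conjectural) input named in the notebook.
-/

namespace Summit.BirchSwinnertonDyer.BirchSwinnertonDyer.Theorems

open Matrix

/-- For a symmetric `S` and a skew-symmetric `A` (any size, any commutative ring),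
`det (x • S + w • A) = det (x • S - w • A)`: the determinant is an even function of `w`.
Proof: transpose. -/
theorem soloInformed_det_symm_add_skew {n : Type*} [Fintype n] [DecidableEq n] {R : Type*}
    [CommRing R] (S A : Matrix n n R) (hS : Sᵀ = S) (hA : Aᵀ = -A) (x w : R) :
    (x • S + w • A).det = (x • S - w • A).det := by
  rw [← Matrix.det_transpose (x • S + w • A), Matrix.transpose_add, Matrix.transpose_smul,
    Matrix.transpose_smul, hS, hA, smul_neg, sub_eq_add_neg]

/-- The same evenness written as `w ↦ -w` invariance. -/
theorem soloInformed_det_symm_add_skew_neg {n : Type*} [Fintype n] [DecidableEq n] {R : Type*}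
    [CommRing R] (S A : Matrix n n R) (hS : Sᵀ = S) (hA : Aᵀ = -A) (x w : R) :
    (x • S + (-w) • A).det = (x • S + w • A).det := by
  rw [neg_smul, ← sub_eq_add_neg]
  exact (soloInformed_det_symm_add_skew S A hS hA x w).symm

/-- Rank two, explicitly: for `S = !![s₁₁, s₁₂; s₁₂, s₂₂]` and `A = !![0, c; -c, 0]`,
`det (x • S + w • A) = x² (s₁₁ s₂₂ - s₁₂²) + w² c²` — no `x w` term, and the `w²`-coefficient
is the square of the Pfaffian. -/
theorem soloInformed_det_fin_two_leadingForm {R : Type*} [CommRing R]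
    (s₁₁ s₁₂ s₂₂ c x w : R) :
    (x • !![s₁₁, s₁₂; s₁₂, s₂₂] + w • !![(0 : R), c; -c, 0]).det
      = x ^ 2 * (s₁₁ * s₂₂ - s₁₂ ^ 2) + w ^ 2 * c ^ 2 := by
  rw [Matrix.det_fin_two]
  simp only [Matrix.add_apply, Matrix.smul_apply, Matrix.of_apply, Matrix.cons_val',
    Matrix.cons_val_zero, Matrix.cons_val_one, Matrix.empty_val', Matrix.cons_val_fin_one,
    smul_eq_mul]
  ring

/-- Square classes: in a field, if `d ≠ 0` then `c² / d = (c / d)² · d`, so the ratio of the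
`w²`- to the `x²`-coefficient, `c² / det S`, lies in the square class of `det S` (when `c ≠ 0`). -/
theorem soloInformed_ratio_class {F : Type*} [Field F] (c d : F) (hd : d ≠ 0) :
    c ^ 2 / d = (c / d) ^ 2 * d := by
  field_simp

/-- … and consequently `(c² / d) · d⁻¹ = (c/d)²` is a square: `c²/d` and `d` have the same class
in `Fˣ/(Fˣ)²`. -/
theorem soloInformed_ratio_class_isSquare {F : Type*} [Field F] (c d : F) (hd : d ≠ 0) :
    IsSquare (c ^ 2 / d * d⁻¹) :=
  ⟨c / d, by rw [soloInformed_ratio_class c d hd]; field_simp⟩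

end Summit.BirchSwinnertonDyer.BirchSwinnertonDyer.Theorems
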